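import Summits.QuantumAdvantage.QuantumAdvantage.Theorems.ScaleDialE
import Summits.QuantumAdvantage.QuantumAdvantage.Theses.ScaleDial
import Summits.QuantumAdvantage.QuantumAdvantage.Theses.DegreeDial
import Summits.QuantumAdvantage.QuantumAdvantage.Theorems.AbsorptionDialE
import HarnessLib
import HarnessLib.Audit

/-!
# RateDial, part A/2: the degree-exponent × loss-exponent GRID (`QFracDeg`, `PolyDeg`, `HardDeg`), the NON-UNIFORM
aggregates and UNIFORMITY pieces (`QFracW3`/`ExpUnif3`, `PolyLossW3`/`PolyUnif3`, `HardW3`/`ThetaUnif3`), and the PROVED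
cell `c = 0` (`qFracW3_zero`, `polyLossW3_zero` from `AffBells37.affBellsPolyLoss3`; root-storey dictionary
`hardDeg_zero_iff_ringAffineBellsLt3`) — support for item stmt-QuantumAdvantage-26910 (`Theses.ScaleDial.MesoHi3`)

Cell decomp-qadv, seat lens-1 («grading / quantitative ladder»), generation 13 — land port of §0/§W/§R of the node
«RateDial» (published under the cell's HOME/decomp-qadv-lens-1/g13/RateDial.lean, record NODE-g13.md; RESIDUAL MODE,
BLOCKER-FIRST on ScaleDial:26910 `MesoHi3 := OctLoss3 → QFracU3`).  The node file with ONLY the namespace renamed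
`Theses.RateDial → Theorems.RateDial` and split at a section boundary.  Prop-defs = the node's cells / aggregates /
pieces only; data def `affPoly` (the affine dictionary).  No `sorry`, no new axioms, no instances, no notation.
-/

set_option linter.dupNamespace false
set_option linter.style.longLine false

noncomputable section

open scoped Classical

namespace Summit.QuantumAdvantage.QuantumAdvantage.Theorems.RateDial

open Finset
open Literature.Computability.QuantumComplexity Literature.Computability.QuantumComplexity.RingHLF
open Literature.Computability.MetaComplexity Literature.Computability.MetaComplexity.Smolensky
open Summit.QuantumAdvantage.AdviceFreeQNC0
open Summit.QuantumAdvantage.QuantumAdvantage.Theses.ExactnessDial (NoPerfectOdd3 PolyLossOddU3 MassStep3u OddToAll3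
  DPLift3 ExactDegreeLogIO3)
open Summit.QuantumAdvantage.QuantumAdvantage.Theorems.ScaleDial (losers winners QML3 QFracU3 CovQFracU3 MesoLift3
  MesoLiftExact3 TopLift3 oct OctLoss3 MesoLo3 MesoHi3 NoPerfectQuarter3 NoPerfectSqrt3 winners_card_eq losers_card_le
  qFracU3_of_polyLossOddU3 logpow_add_logpow_le qml3_of_qFracU3 noPerfectOdd3_of_qml3 noPerfectOdd3_of_qFracU3
  polyLossOddU3_of_ringHardOdd3 oct_le_sqrt qml3_of_octLoss3 octLoss3_of_qFracU3 mesoLift3_iff_oct massStep3u_iff_three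
  three_of_polyLossOddU3 closes₄ octLoss3_of_noPerfectQuarter3 mesoLo3_of_noPerfectQuarter3 noPerfectOdd3_iff_qml3
  cov_of_qFracU3 qFracU3_of_cov)
open Summit.QuantumAdvantage.QuantumAdvantage.Theorems.RingPeriodFold (cov covStrat covStrat_mem_lowDeg)
open Summit.QuantumAdvantage.QuantumAdvantage.Theorems.RingSymmetrization3 (filter_cov_eq)

/-! ## §0  The graded objects: one cell `(c, B)` of the degree-exponent × loss-exponent grid -/

/-- **`QFracDeg c B` — one cell of the exchange-rate grid**: eventually, every strategy of `𝔽₃`-degree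
`≤ (log₂ n)^c` wins at most a `(1 − 2^{−(log₂ n)^B})` fraction of the odd class (loss FRACTION at least
quasi-polynomial with loss exponent `B`, at degree exponent `c`).  `QFracU3 = ∃ B, ∀ c, QFracDeg c B`
(`qFracU3_iff_deg`, by `Iff.rfl`); the NON-UNIFORM aggregate is `QFracW3 = ∀ c, ∃ B, QFracDeg c B`. -/
def QFracDeg (c B : ℕ) : Prop :=
  ∃ n₀ : ℕ, ∀ n ≥ n₀, ∀ P : Fin n → CubeFn (ZMod 3) n,
    (∀ i, P i ∈ lowDeg (ZMod 3) n ((Nat.log 2 n) ^ c)) →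
      ((winners n P).card : ℝ) ≤ (1 - 1 / (2 : ℝ) ^ ((Nat.log 2 n) ^ B)) * (2 : ℝ) ^ (n - 1)

/-- **`PolyDeg c C`** — the same cell one storey up (inverse-POLYNOMIAL loss fraction `n^{−C}` at degree exponent
`c`); `PolyLossOddU3 = ∃ C, ∀ c, PolyDeg c C` (`polyLossOddU3_iff_deg`). -/
def PolyDeg (c C : ℕ) : Prop :=
  ∃ n₀ : ℕ, ∀ n ≥ n₀, ∀ P : Fin n → CubeFn (ZMod 3) n,
    (∀ i, P i ∈ lowDeg (ZMod 3) n ((Nat.log 2 n) ^ c)) →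
      ((winners n P).card : ℝ) ≤ (1 - 1 / (n : ℝ) ^ C) * (2 : ℝ) ^ (n - 1)

/-- **`HardDeg c θ`** — the same cell at the ROOT storey (constant loss fraction `1 − θ` at degree exponent `c`);
`RingHardOdd 3 = ∃ θ < 1, ∀ c, HardDeg c θ` (`ringHardOdd3_iff_deg`). -/
def HardDeg (c : ℕ) (θ : ℝ) : Prop :=
  ∃ n₀ : ℕ, ∀ n ≥ n₀, ∀ P : Fin n → CubeFn (ZMod 3) n,
    (∀ i, P i ∈ lowDeg (ZMod 3) n ((Nat.log 2 n) ^ c)) →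
      ((winners n P).card : ℝ) ≤ θ * (2 : ℝ) ^ (n - 1)

/-- RateDialA helper `qFracU3_iff_deg` (decomp-qadv land package; see the module docstring). -/
theorem qFracU3_iff_deg : QFracU3 ↔ ∃ B : ℕ, ∀ c : ℕ, QFracDeg c B := Iff.rfl

/-- RateDialA helper `polyLossOddU3_iff_deg` (decomp-qadv land package; see the module docstring). -/
theorem polyLossOddU3_iff_deg : PolyLossOddU3 ↔ ∃ C : ℕ, ∀ c : ℕ, PolyDeg c C := Iff.rfl

/-- RateDialA helper `ringHardOdd3_iff_deg` (decomp-qadv land package; see the module docstring). -/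
theorem ringHardOdd3_iff_deg : RingHardOdd 3 ↔ ∃ θ : ℝ, θ < 1 ∧ ∀ c : ℕ, HardDeg c θ := Iff.rfl

/-! ### monotonicity inside the grid (down in `c`, up in `B` / `C` / `θ`) -/

/-- RateDialA helper `lowDeg_logpow_mono` (decomp-qadv land package; see the module docstring). -/
theorem lowDeg_logpow_mono {n c c' : ℕ} (h : c ≤ c') (hn : 2 ≤ n) :
    lowDeg (ZMod 3) n ((Nat.log 2 n) ^ c) ≤ lowDeg (ZMod 3) n ((Nat.log 2 n) ^ c') :=
  lowDeg_mono (Nat.pow_le_pow_right (Nat.log_pos (by norm_num) hn) h)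

/-- RateDialA helper `qFracDeg_anti` (decomp-qadv land package; see the module docstring). -/
theorem qFracDeg_anti {c c' B : ℕ} (h : c ≤ c') (hq : QFracDeg c' B) : QFracDeg c B := by
  obtain ⟨n₀, hn₀⟩ := hq
  refine ⟨max n₀ 2, fun n hn P hP => hn₀ n (le_trans (le_max_left _ _) hn) P fun i => ?_⟩
  exact lowDeg_logpow_mono h (le_trans (le_max_right _ _) hn) (hP i)

/-- RateDialA helper `polyDeg_anti` (decomp-qadv land package; see the module docstring). -/
theorem polyDeg_anti {c c' C : ℕ} (h : c ≤ c') (hq : PolyDeg c' C) : PolyDeg c C := by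
  obtain ⟨n₀, hn₀⟩ := hq
  refine ⟨max n₀ 2, fun n hn P hP => hn₀ n (le_trans (le_max_left _ _) hn) P fun i => ?_⟩
  exact lowDeg_logpow_mono h (le_trans (le_max_right _ _) hn) (hP i)

/-- RateDialA helper `hardDeg_anti` (decomp-qadv land package; see the module docstring). -/
theorem hardDeg_anti {c c' : ℕ} {θ : ℝ} (h : c ≤ c') (hq : HardDeg c' θ) : HardDeg c θ := by
  obtain ⟨n₀, hn₀⟩ := hq
  refine ⟨max n₀ 2, fun n hn P hP => hn₀ n (le_trans (le_max_left _ _) hn) P fun i => ?_⟩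
  exact lowDeg_logpow_mono h (le_trans (le_max_right _ _) hn) (hP i)

/-- RateDialA helper `qFracDeg_mono` (decomp-qadv land package; see the module docstring). -/
theorem qFracDeg_mono {c B B' : ℕ} (h : B ≤ B') (hq : QFracDeg c B) : QFracDeg c B' := by
  obtain ⟨n₀, hn₀⟩ := hq
  refine ⟨max n₀ 2, fun n hn P hP => (hn₀ n (le_trans (le_max_left _ _) hn) P hP).trans ?_⟩
  have hn2 : 2 ≤ n := le_trans (le_max_right _ _) hn
  have hL : 1 ≤ Nat.log 2 n := Nat.log_pos (by norm_num) hn2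
  have hpow : (2 : ℝ) ^ ((Nat.log 2 n) ^ B) ≤ (2 : ℝ) ^ ((Nat.log 2 n) ^ B') :=
    pow_le_pow_right₀ (by norm_num) (Nat.pow_le_pow_right hL h)
  have h1 : 1 / (2 : ℝ) ^ ((Nat.log 2 n) ^ B') ≤ 1 / (2 : ℝ) ^ ((Nat.log 2 n) ^ B) :=
    one_div_le_one_div_of_le (pow_pos (by norm_num) _) hpow
  exact mul_le_mul_of_nonneg_right (by linarith) (by positivity)

/-- numeric core, one storey down: `n^C ≤ 2^((log₂ n)^(C+1))` for `n ≥ 4`, as a comparison of the two bounds. -/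
theorem quasiBound_of_polyBound (C : ℕ) {n : ℕ} (hn4 : 4 ≤ n) :
    (1 - 1 / (n : ℝ) ^ C) * (2 : ℝ) ^ (n - 1) ≤ (1 - 1 / (2 : ℝ) ^ ((Nat.log 2 n) ^ (C + 1))) * (2 : ℝ) ^ (n - 1) := by
  refine mul_le_mul_of_nonneg_right ?_ (by positivity)
  set L := Nat.log 2 n with hL
  have hL2 : 2 ≤ L := Nat.le_log_of_pow_le (by norm_num) hn4
  have hnlt : n < 2 ^ (L + 1) := Nat.lt_pow_succ_log_self (by norm_num) n
  have hexp : (L + 1) * C ≤ L ^ (C + 1) := by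
    rcases Nat.eq_zero_or_pos C with hC0 | hCpos
    · subst hC0; simp
    · have h2 : L + 1 ≤ L * L := by nlinarith
      have h3 : C ≤ L ^ (C - 1) * 1 := by
        rw [mul_one]
        calc C ≤ 2 ^ (C - 1) := by
              have := Nat.lt_two_pow_self (n := C - 1)
              omega
          _ ≤ L ^ (C - 1) := Nat.pow_le_pow_left hL2 _
      calc (L + 1) * C ≤ (L * L) * L ^ (C - 1) := Nat.mul_le_mul h2 (by simpa using h3)
        _ = L ^ (C - 1 + 2) := by ring
        _ = L ^ (C + 1) := by congr 1; omega
  have hpow : ((n : ℝ)) ^ C ≤ (2 : ℝ) ^ (L ^ (C + 1)) := by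
    have : (n : ℝ) ^ C ≤ ((2 : ℝ) ^ (L + 1)) ^ C := by
      gcongr; exact_mod_cast hnlt.le
    refine this.trans ?_
    rw [← pow_mul]
    exact pow_le_pow_right₀ (by norm_num) hexp
  have hn0 : (0 : ℝ) < n := by exact_mod_cast (show 0 < n by omega)
  have hnpos : (0 : ℝ) < (n : ℝ) ^ C := pow_pos hn0 C
  have : 1 / (2 : ℝ) ^ (L ^ (C + 1)) ≤ 1 / (n : ℝ) ^ C := one_div_le_one_div_of_le hnpos hpow
  linarith

/-- one storey down, cell by cell: `PolyDeg c C → QFracDeg c (C+1)` (the per-degree form of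
`ScaleDial.qFracU3_of_polyLossOddU3`). -/
theorem qFracDeg_of_polyDeg {c C : ℕ} (h : PolyDeg c C) : QFracDeg c (C + 1) := by
  obtain ⟨n₀, hn₀⟩ := h
  exact ⟨max n₀ 4, fun n hn P hP =>
    (hn₀ n (le_trans (le_max_left _ _) hn) P hP).trans (quasiBound_of_polyBound C (le_trans (le_max_right _ _) hn))⟩

/-- numeric core at the root: for `θ < 1`, eventually `θ ≤ 1 − 1/n`, as a comparison of the two bounds. -/
theorem polyBound_of_thetaBound {θ : ℝ} (hθ : θ < 1) :
    ∃ n₁ : ℕ, ∀ n ≥ n₁, θ * (2 : ℝ) ^ (n - 1) ≤ (1 - 1 / (n : ℝ) ^ 1) * (2 : ℝ) ^ (n - 1) := by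
  obtain ⟨N, hN⟩ := exists_nat_gt (1 / (1 - θ))
  refine ⟨N + 1, fun n hn => ?_⟩
  have hnN : (N : ℝ) + 1 ≤ n := by exact_mod_cast hn
  have h1θ : 0 < 1 - θ := by linarith
  have hNpos : (0 : ℝ) < 1 / (1 - θ) := by positivity
  have hn0 : (0 : ℝ) < n := by linarith
  refine mul_le_mul_of_nonneg_right ?_ (by positivity)
  rw [pow_one]
  have : 1 / (n : ℝ) ≤ 1 - θ := by
    rw [div_le_iff₀ hn0]
    have : 1 < (1 - θ) * ((N : ℝ) + 1) := by
      have := mul_lt_mul_of_pos_left hN h1θ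
      rw [mul_one_div_cancel h1θ.ne'] at this
      nlinarith
    nlinarith
  linarith

/-- one storey down at the root: `HardDeg c θ → PolyDeg c 1` for `θ < 1` (constant loss ⟹ `1/n` loss). -/
theorem polyDeg_of_hardDeg {c : ℕ} {θ : ℝ} (hθ : θ < 1) (h : HardDeg c θ) : PolyDeg c 1 := by
  obtain ⟨n₀, hn₀⟩ := h
  obtain ⟨n₁, hn₁⟩ := polyBound_of_thetaBound hθ
  exact ⟨max n₀ n₁, fun n hn P hP =>
    (hn₀ n (le_trans (le_max_left _ _) hn) P hP).trans (hn₁ n (le_trans (le_max_right _ _) hn))⟩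

/-! ## §W  The NON-UNIFORM aggregates (`∀ c, ∃ exponent`) and the UNIFORMITY pieces (`∀∃ → ∃∀`) -/

/-- **QFracW3** — every degree exponent `c` has SOME loss exponent `B(c)` (the rate function `c ↦ B(c)` is
everywhere FINITE; `QFracU3` says it is BOUNDED). [W · T-implied · UNDECIDED · graded by `c`: `c = 0` PROVED
(`qFracW3_zero`), `c ≥ 1` IDEA-NEEDED] -/
def QFracW3 : Prop := ∀ c : ℕ, ∃ B : ℕ, QFracDeg c B

/-- **PolyLossW3** — the non-uniform 26531: every `c` has SOME polynomial loss exponent `C(c)`. -/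
def PolyLossW3 : Prop := ∀ c : ℕ, ∃ C : ℕ, PolyDeg c C

/-- **HardW3** — the non-uniform ROOT: every `c` has SOME `θ(c) < 1` (the folklore per-depth separation; the
registered leaf `RingHardOdd 3` demands ONE `θ` for all `c`). -/
def HardW3 : Prop := ∀ c : ℕ, ∃ θ : ℝ, θ < 1 ∧ HardDeg c θ

/-- **ExpUnif3 — UNIFORMITY OF THE LOSS EXPONENT** [W · T-implied (`pieces_of_polyLossOddU3`) · strictly below
`MesoHi3` (`(mesoHi3_iff_rate).1`; the converse would prove `MesoW3`) · UNDECIDED · leaf IDEA-NEEDED ·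
INSTRUMENTABLE (rate census)]: if every degree exponent has a loss exponent, then ONE loss exponent serves all —
the rate function `c ↦ B(c)` of the cycle's odd class is bounded.  Nearest prior in the tree: PumpingDial's
`UniformityLift3` (27306) = uniformity of `θ` over gated-LOCAL rule TYPES at the constant-loss storey; here the
class is ALL polynomial strategies graded by DEGREE EXPONENT and the storey is the quasi-polynomial one, where
symmetrisation holds cell by cell. -/
def ExpUnif3 : Prop := QFracW3 → QFracU3

/-- **PolyUnif3** — uniformity of the polynomial loss exponent (the same move at the junction 26531). -/
def PolyUnif3 : Prop := PolyLossW3 → PolyLossOddU3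

/-- **ThetaUnif3** — uniformity of `θ` in the degree exponent (the same move at the ROOT of the rung). -/
def ThetaUnif3 : Prop := HardW3 → RingHardOdd 3

/-- RateDialA helper `qFracW3_of_qFracU3` (decomp-qadv land package; see the module docstring). -/
theorem qFracW3_of_qFracU3 (h : QFracU3) : QFracW3 := fun c => by
  obtain ⟨B, hB⟩ := h; exact ⟨B, hB c⟩

/-- RateDialA helper `polyLossW3_of_polyLossOddU3` (decomp-qadv land package; see the module docstring). -/
theorem polyLossW3_of_polyLossOddU3 (h : PolyLossOddU3) : PolyLossW3 := fun c => by
  obtain ⟨C, hC⟩ := h; exact ⟨C, hC c⟩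

/-- RateDialA helper `hardW3_of_ringHardOdd3` (decomp-qadv land package; see the module docstring). -/
theorem hardW3_of_ringHardOdd3 (h : RingHardOdd 3) : HardW3 := fun c => by
  obtain ⟨θ, hθ, hh⟩ := h; exact ⟨θ, hθ, hh c⟩

/-- storey to storey, non-uniformly: `HardW3 → PolyLossW3 → QFracW3`. -/
theorem polyLossW3_of_hardW3 (h : HardW3) : PolyLossW3 := fun c => by
  obtain ⟨θ, hθ, hh⟩ := h c; exact ⟨1, polyDeg_of_hardDeg hθ hh⟩

/-- RateDialA helper `qFracW3_of_polyLossW3` (decomp-qadv land package; see the module docstring). -/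
theorem qFracW3_of_polyLossW3 (h : PolyLossW3) : QFracW3 := fun c => by
  obtain ⟨C, hC⟩ := h c; exact ⟨C + 1, qFracDeg_of_polyDeg hC⟩

/-- **the quantifier-order identity at three storeys** (`∃∀ ⟺ ∀∃ ∧ (∀∃ → ∃∀)`). -/
theorem qFracU3_iff_unif : QFracU3 ↔ (QFracW3 ∧ ExpUnif3) :=
  ⟨fun h => ⟨qFracW3_of_qFracU3 h, fun _ => h⟩, fun h => h.2 h.1⟩

/-- RateDialA helper `polyLossOddU3_iff_unif` (decomp-qadv land package; see the module docstring). -/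
theorem polyLossOddU3_iff_unif : PolyLossOddU3 ↔ (PolyLossW3 ∧ PolyUnif3) :=
  ⟨fun h => ⟨polyLossW3_of_polyLossOddU3 h, fun _ => h⟩, fun h => h.2 h.1⟩

/-- RateDialA helper `ringHardOdd3_iff_unif` (decomp-qadv land package; see the module docstring). -/
theorem ringHardOdd3_iff_unif : RingHardOdd 3 ↔ (HardW3 ∧ ThetaUnif3) :=
  ⟨fun h => ⟨hardW3_of_ringHardOdd3 h, fun _ => h⟩, fun h => h.2 h.1⟩

/-! ## §R  The PROVED bottom rung of the non-uniform side: degree exponent `c = 0` (affine strategies)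

`(log₂ n)^0 = 1`: the cell `c = 0` is the class of AFFINE `𝔽₃` strategies, and `AffBells37.affBellsPolyLoss3`
(tree, unconditional: every affine MOD₃ bell strategy loses `≥ N^{-e}` of the odd class) is exactly `∃ C, PolyDeg 0 C`
through the dictionary `affine_of_mem_lowDeg_one` (tree, `AbsorptionDialE`).  So the rate function is FINITE at
`c = 0` at the polynomial and quasi-polynomial storeys (`polyLossW3_zero`, `qFracW3_zero`); at the root storey the
`c = 0` cell `∃ θ < 1, HardDeg 0 θ` is `RingAffineBellsLt3` (OPEN; DegreeDial's `AffineCore3`). -/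

/-- dictionary: a degree-`≤ 1` strategy IS an affine bell strategy (`AffBells23.affBell`). -/
theorem exists_affBell_of_deg_one {n : ℕ} {P : Fin n → CubeFn (ZMod 3) n} (hP : ∀ i, P i ∈ lowDeg (ZMod 3) n 1) :
    ∃ (β : Fin n → Fin n → ZMod 3) (c : Fin n → ZMod 3),
      ∀ x, (fun i => decide (P i x = 1)) = AffBells23.affBell β c x := by
  choose a₀ a ha using fun i => Theorems.AbsorptionDial.affine_of_mem_lowDeg_one (hP i)
  refine ⟨a, fun i => 1 - a₀ i, fun x => funext fun i => ?_⟩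
  have hsum : (∑ j, a i j * (if x j then (1 : ZMod 3) else 0)) = ∑ j, (if x j then a i j else 0) :=
    Finset.sum_congr rfl fun j _ => by split_ifs <;> simp
  simp only [AffBells23.affBell, ha, hsum]
  by_cases h : (∑ j, if x j then a i j else 0) = 1 - a₀ i
  · rw [decide_eq_true h, decide_eq_true]
    rw [h]; ring
  · rw [decide_eq_false h, decide_eq_false]
    intro h'
    exact h (by rw [← h']; ring)

/-- dictionary, counted: the odd-class win count of a degree-`≤ 1` strategy is an `affWinCard`. -/
theorem winners_card_eq_affWinCard {n : ℕ} {P : Fin n → CubeFn (ZMod 3) n} (hP : ∀ i, P i ∈ lowDeg (ZMod 3) n 1) :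
    ∃ (β : Fin n → Fin n → ZMod 3) (c : Fin n → ZMod 3), (winners n P).card = AffBells23.affWinCard β c := by
  obtain ⟨β, c, hβ⟩ := exists_affBell_of_deg_one hP
  refine ⟨β, c, ?_⟩
  unfold AffBells23.affWinCard
  congr 1
  ext x
  simp only [winners, mem_filter, mem_univ, true_and, hβ x]

/-- **RUNG (c = 0, polynomial storey) PROVED**: `∃ C, PolyDeg 0 C` — by name from `AffBells37.affBellsPolyLoss3`. -/
theorem polyLossW3_zero : ∃ C : ℕ, PolyDeg 0 C := by
  obtain ⟨e, n₀, h⟩ := AffBells37.affBellsPolyLoss3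
  refine ⟨e, n₀, fun n hn P hP => ?_⟩
  have hP1 : ∀ i, P i ∈ lowDeg (ZMod 3) n 1 := by simpa using hP
  obtain ⟨β, c, hcard⟩ := winners_card_eq_affWinCard hP1
  rw [hcard]
  exact h n hn β c

/-- **RUNG (c = 0, quasi-polynomial storey) PROVED**: `∃ B, QFracDeg 0 B`. -/
theorem qFracW3_zero : ∃ B : ℕ, QFracDeg 0 B := by
  obtain ⟨C, hC⟩ := polyLossW3_zero
  exact ⟨C + 1, qFracDeg_of_polyDeg hC⟩

/-! ### the ROOT storey at `c = 0` is crux `RingAffineBellsLt3` (22907-family; DegreeDial's `AffineCore3`)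

The dictionary in the other direction: an affine bell `(β, c)` IS a degree-`≤ 1` strategy (`affPoly_mem_lowDeg_one`),
so the cell `∃ θ < 1, HardDeg 0 θ` is LITERALLY `BondTwist3.RingAffineBellsLt3` (`hardDeg_zero_iff_ringAffineBellsLt3`):
the rate function at the root storey is finite at `c = 0` iff crux `RingAffineBellsLt3` holds (OPEN). -/

/-- the affine polynomial of a bell: `x ↦ ⟨β_k, x⟩ + (1 − c_k)` (so `= 1 ⟺ ⟨β_k, x⟩ = c_k`). -/
def affPoly {n : ℕ} (β : Fin n → Fin n → ZMod 3) (c : Fin n → ZMod 3) (k : Fin n) : CubeFn (ZMod 3) n :=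
  fun x => (∑ i, if x i then β k i else 0) + (1 - c k)

/-- RateDialA helper `affPoly_mem_lowDeg_one` (decomp-qadv land package; see the module docstring). -/
theorem affPoly_mem_lowDeg_one {n : ℕ} (β : Fin n → Fin n → ZMod 3) (c : Fin n → ZMod 3) (k : Fin n) :
    affPoly β c k ∈ lowDeg (ZMod 3) n 1 := by
  have h : affPoly β c k = (1 - c k) • mono (ZMod 3) (∅ : Finset (Fin n)) + ∑ i, (β k i) • mono (ZMod 3) {i} := by
    funext x
    simp only [affPoly, Pi.add_apply, Pi.smul_apply, Finset.sum_apply, smul_eq_mul, mono, Finset.prod_empty,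
      Finset.prod_singleton, mul_one, mul_ite, mul_zero]
    rw [add_comm]
  rw [h]
  refine Submodule.add_mem _ (Submodule.smul_mem _ _ (mono_mem_lowDeg (by simp)))
    (Submodule.sum_mem _ fun i _ => Submodule.smul_mem _ _ (mono_mem_lowDeg (by simp)))

/-- RateDialA helper `decide_affPoly` (decomp-qadv land package; see the module docstring). -/
theorem decide_affPoly {n : ℕ} (β : Fin n → Fin n → ZMod 3) (c : Fin n → ZMod 3) (x : Fin n → Bool) :
    (fun k => decide (affPoly β c k x = 1)) = fun k => decide ((∑ i, if x i then β k i else 0) = c k) := by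
  funext k
  simp only [affPoly]
  by_cases h : (∑ i, if x i then β k i else 0) = c k
  · rw [decide_eq_true h, decide_eq_true]
    rw [h]; ring
  · rw [decide_eq_false h, decide_eq_false]
    intro h'
    exact h (by linear_combination h')

/-- **the root-storey cell `c = 0` IS crux `RingAffineBellsLt3`.** -/
theorem hardDeg_zero_iff_ringAffineBellsLt3 : (∃ θ : ℝ, θ < 1 ∧ HardDeg 0 θ) ↔ BondTwist3.RingAffineBellsLt3 := by
  constructor
  · rintro ⟨θ, hθ, n₀, h⟩
    refine ⟨θ, hθ, n₀, fun N hN β c => ?_⟩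
    have hmem : ∀ k, affPoly β c k ∈ lowDeg (ZMod 3) N ((Nat.log 2 N) ^ 0) := fun k => by
      simpa using affPoly_mem_lowDeg_one β c k
    have h1 := h N hN (affPoly β c) hmem
    have hset : winners N (affPoly β c) = univ.filter fun x : Fin N → Bool =>
        OddZeros x ∧ RingHLF.Rel x (fun k => decide ((∑ i : Fin N, if x i then β k i else 0) = c k)) := by
      ext x
      simp only [winners, mem_filter, mem_univ, true_and, decide_affPoly]
    rw [hset] at h1
    convert h1 using 4
  · rintro ⟨θ, hθ, n₀, h⟩
    refine ⟨θ, hθ, n₀, fun n hn P hP => ?_⟩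
    have hP1 : ∀ i, P i ∈ lowDeg (ZMod 3) n 1 := by simpa using hP
    obtain ⟨β, c, hβ⟩ := exists_affBell_of_deg_one hP1
    have h1 := h n hn β c
    have hset : winners n P = univ.filter fun x : Fin n → Bool =>
        OddZeros x ∧ RingHLF.Rel x (fun k => decide ((∑ i : Fin n, if x i then β k i else 0) = c k)) := by
      ext x
      simp only [winners, mem_filter, mem_univ, true_and, hβ x]
      exact Iff.rfl
    rw [hset]
    convert h1 using 4

/-- hence DegreeDial's affine core, read in this grid: `RingAffineBellsLt3 → ∃ θ < 1, HardDeg 0 θ`, and then the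
`c = 0` cells of all three storeys are finite (`polyDeg_of_hardDeg`, `qFracDeg_of_polyDeg`). -/
theorem hardW3_zero_of_ringAffineBellsLt3 (h : BondTwist3.RingAffineBellsLt3) : ∃ θ : ℝ, θ < 1 ∧ HardDeg 0 θ :=
  hardDeg_zero_iff_ringAffineBellsLt3.2 h

/-! ## Axiom guards -/

/-- info: 'Summit.QuantumAdvantage.QuantumAdvantage.Theorems.RateDial.qFracW3_zero' depends on axioms: [propext, Classical.choice, Quot.sound] -/
#guard_msgs (whitespace := lax) in #print axioms qFracW3_zero

/-- info: 'Summit.QuantumAdvantage.QuantumAdvantage.Theorems.RateDial.hardDeg_zero_iff_ringAffineBellsLt3' depends on axioms: [propext, Classical.choice, Quot.sound] -/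
#guard_msgs (whitespace := lax) in #print axioms hardDeg_zero_iff_ringAffineBellsLt3

end Summit.QuantumAdvantage.QuantumAdvantage.Theorems.RateDial

end
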